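import Summits.QuantumAdvantage.QuantumAdvantage.Theorems.CubicForrelationNearExactIsExactAmmCeilingQ
import Summits.QuantumAdvantage.QuantumAdvantage.Theorems.NearExactIsExact.Negative.SkewProductCore

/-!
# `NearExactIsExact` (stmt-QuantumAdvantage-14043), negative side — the FRAME-FREE parity lemma of the
# corner-flat family, in Plücker coordinates

Negative-side support (disprover lane, unit `b2b-cforr-disprove-g33`, 2026-08-23) for the crux
`Summit.QuantumAdvantage.QuantumAdvantage.Theses.CubicForrelation.NearExactIsExact`; strengthens the parity
lemma `…Negative.CornerFlatPolar.cf_parity_deg` (which needs an AFFINE frame `u, v` and a QUADRATIC base point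
`w`) to the hypotheses that are forced by cubicity alone.  HONEST FRAMING: VALUE = THEOREM — NOT summit progress.

**Setting.**  In the corner-flat family `f(x₁‖x₂) = (u(x₁)·x₂)(v(x₁)·x₂) ⊕ b(x₁)·x₂ ⊕ f₀(x₁)` the algebraic normal
form of `f` in `x₂` has quadratic part `Σ_{i<j} p_{ij}(x₁) x₂ᵢx₂ⱼ` with the PLÜCKER VECTOR
`p_{ij} = uᵢvⱼ ⊕ uⱼvᵢ` of the fibre plane `V(x₁) = ⟨u(x₁), v(x₁)⟩`, and linear part `Σ_l ℓ_l(x₁) x₂ₗ` with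
`ℓ_l = b_l ⊕ u_l v_l`.  So `f` is cubic iff `p` is affine, `ℓ` is quadratic and `f₀` is cubic — with NO condition
on the frame `u, v` or on `b` individually (most affine plane fields `x₁ ↦ V(x₁)` have no affine frame at all:
e.g. `28224` of the `59207` affine plane fields on `𝔽₂³` with values in `𝔽₂⁵` and `V(0)` fixed are frameless).

**Frame-free parity lemma** (`cfp_parity_deg`).  For cubic `h : 𝔽₂^m → 𝔽₂` and maps `b u v : 𝔽₂^a → 𝔽₂^m` with
`p` affine and `ℓ` quadratic, the four-corner sum `x ↦ ⊕_{σ,τ} h(b(x) ⊕ σu(x) ⊕ τv(x))` has degree `≤ 3`.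
Proof: expand `h` into monomials (`IsDegLeFun` is a polynomial of total degree `≤ 3`, `cfp_eval_ind`); the
corner sum is additive in `h` (`isDegLeFun_sum`), and for a single monomial `y_S`, `|S| ≤ 3`, it is an explicit
polynomial of degree `≤ 3` in `(p, ℓ)` (`cfp_monomial_deg`): `0` for `|S| ≤ 1`, `p_{ij}` for `S = {i,j}`, and for
`S = {i,j,k}` the FRAME-FREE PARITY FORMULA
`p_{ij}p_{ik} ⊕ p_{ij}p_{jk} ⊕ p_{ik}p_{jk} ⊕ ℓᵢ p_{jk} ⊕ ℓⱼ p_{ik} ⊕ ℓ_k p_{ij}` (`cfp_corner3`, a `2⁹`-case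
Boolean identity; the cubic Plücker terms `p_{ij}p_{ik}p_{jk}` of the two naive pieces cancel).
Consequence (in `…Negative.CornerFlatParity`): the `15/16` ceiling for corner-flat pairs with a non-bent partner
holds on the whole corner-flat habitat, not only on its framed part.  Standard three axioms only.
-/

set_option linter.dupNamespace false -- D-0017: single-problem summit ⇒ `QuantumAdvantage.QuantumAdvantage` by design

noncomputable section

namespace Summit.QuantumAdvantage.QuantumAdvantage.Theorems.NearExactIsExact.Negative.CornerFlatPluecker

open Finset
open Literature.Computability.QuantumComplexity
open Literature.Computability.QuantumComplexity.BuzetChailloux (bxor)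
open Summit.QuantumAdvantage.QuantumAdvantage.Theorems.CubicForrelation.NearExactIsExact
open Summit.QuantumAdvantage.QuantumAdvantage.Theorems.NearExactIsExact.Negative.SkewProductCore (ind ind_and ind_xor
  decide_ind_eq_one isDegLeFun_sum)

variable {a m : ℕ}

/-! ### Boolean points of `𝔽₂`-polynomials -/

/-- `[y]^e = [y]` in `𝔽₂` for `e ≠ 0`. [folklore] -/
theorem cfp_ind_pow (y : Bool) {e : ℕ} (he : e ≠ 0) : ind y ^ e = ind y := by
  cases y
  · show (0 : ZMod 2) ^ e = 0
    exact zero_pow he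
  · show (1 : ZMod 2) ^ e = 1
    exact one_pow e

/-- Evaluation of an `𝔽₂`-polynomial at a Boolean point, monomial by monomial:
`p(y) = Σ_{d ∈ supp p} coeff_d(p) · Π_{i ∈ supp d} [yᵢ]` (exponents `≥ 1` collapse on `{0,1}`).
[cite: Carlet2020, §2.2.1 eq. (2.1)] -/
theorem cfp_eval_ind (p : MvPolynomial (Fin m) (ZMod 2)) (y : Fin m → Bool) :
    MvPolynomial.eval (fun j => if y j then (1 : ZMod 2) else 0) p =
      ∑ d ∈ p.support, p.coeff d * ∏ i ∈ d.support, ind (y i) := by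
  rw [MvPolynomial.eval_eq]
  refine sum_congr rfl fun d _ => ?_
  congr 1
  exact prod_congr rfl fun i hi => cfp_ind_pow (y i) (Finsupp.mem_support_iff.mp hi)

/-- A monomial of a polynomial of total degree `≤ 3` involves at most `3` variables. [folklore] -/
theorem cfp_card_support_le {p : MvPolynomial (Fin m) (ZMod 2)} (hp : p.totalDegree ≤ 3) {d : Fin m →₀ ℕ}
    (hd : d ∈ p.support) : d.support.card ≤ 3 := by
  have h1 : (d.sum fun _ e => e) ≤ 3 := (MvPolynomial.le_totalDegree hd).trans hp
  have h2 : d.support.card ≤ d.sum fun _ e => e := by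
    show d.support.card ≤ ∑ i ∈ d.support, d i
    rw [card_eq_sum_ones]
    exact sum_le_sum fun i hi => Nat.one_le_iff_ne_zero.mpr (Finsupp.mem_support_iff.mp hi)
  exact h2.trans h1

/-! ### The four-corner sum of a monomial, in Plücker coordinates -/

/-- One variable: `⊕_{σ,τ} (b ⊕ σu ⊕ τv)ᵢ = 0`. [folklore] -/
theorem cfp_corner1 : ∀ bi ui vi : Bool, (bi ^^ (bi ^^ ui) ^^ (bi ^^ vi) ^^ (bi ^^ (ui ^^ vi))) = false := by
  decide

/-- Two variables: `⊕_{σ,τ} (b ⊕ σu ⊕ τv)ᵢ (b ⊕ σu ⊕ τv)ⱼ = p_{ij} = uᵢvⱼ ⊕ uⱼvᵢ` (the Plücker coordinate).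
[folklore] -/
theorem cfp_corner2 : ∀ bi bj ui uj vi vj : Bool,
    ((bi && bj) ^^ ((bi ^^ ui) && (bj ^^ uj)) ^^ ((bi ^^ vi) && (bj ^^ vj)) ^^
      ((bi ^^ (ui ^^ vi)) && (bj ^^ (uj ^^ vj)))) = ((ui && vj) ^^ (uj && vi)) := by
  decide

/-- Three variables — the FRAME-FREE PARITY FORMULA:
`⊕_{σ,τ} Π_{l∈{i,j,k}} (b ⊕ σu ⊕ τv)_l = p_{ij}p_{ik} ⊕ p_{ij}p_{jk} ⊕ p_{ik}p_{jk} ⊕ ℓᵢp_{jk} ⊕ ℓⱼp_{ik} ⊕ ℓ_kp_{ij}`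
with `p_{ij} = uᵢvⱼ ⊕ uⱼvᵢ` and `ℓ_l = b_l ⊕ u_lv_l` (a `2⁹`-case identity). [folklore] -/
theorem cfp_corner3 : ∀ bi bj bk ui uj uk vi vj vk : Bool,
    ((bi && (bj && bk)) ^^ ((bi ^^ ui) && ((bj ^^ uj) && (bk ^^ uk))) ^^
        ((bi ^^ vi) && ((bj ^^ vj) && (bk ^^ vk))) ^^
        ((bi ^^ (ui ^^ vi)) && ((bj ^^ (uj ^^ vj)) && (bk ^^ (uk ^^ vk))))) =
      (((((ui && vj) ^^ (uj && vi)) && ((ui && vk) ^^ (uk && vi))) ^^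
            (((ui && vj) ^^ (uj && vi)) && ((uj && vk) ^^ (uk && vj))) ^^
            (((ui && vk) ^^ (uk && vi)) && ((uj && vk) ^^ (uk && vj)))) ^^
          ((bi ^^ (ui && vi)) && ((uj && vk) ^^ (uk && vj))) ^^
          ((bj ^^ (uj && vj)) && ((ui && vk) ^^ (uk && vi))) ^^
          ((bk ^^ (uk && vk)) && ((ui && vj) ^^ (uj && vi)))) := by
  decide

/-- The four-corner sum `x ↦ Σ_{σ,τ} Π_{i∈S} [(b(x) ⊕ σu(x) ⊕ τv(x))ᵢ]` of a monomial `y_S` with `|S| ≤ 3` has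
degree `≤ 3` in `x` as soon as the Plücker coordinates `x ↦ uᵢvⱼ ⊕ uⱼvᵢ` are affine and the twisted base
point `x ↦ bᵢ ⊕ uᵢvᵢ` is quadratic (by `cfp_corner1/2/3`). [folklore] -/
theorem cfp_monomial_deg (S : Finset (Fin m)) (hS : S.card ≤ 3) {b u v : (Fin a → Bool) → (Fin m → Bool)}
    (hp : ∀ i j, IsDegLeFun 1 (fun x => (u x i && v x j) ^^ (u x j && v x i)))
    (hl : ∀ i, IsDegLeFun 2 (fun x => b x i ^^ (u x i && v x i))) :
    IsDegLeFun 3 (fun x => decide (((∏ i ∈ S, ind (b x i)) + (∏ i ∈ S, ind (bxor (b x) (u x) i)) +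
      (∏ i ∈ S, ind (bxor (b x) (v x) i)) + ∏ i ∈ S, ind (bxor (b x) (bxor (u x) (v x)) i)) = 1)) := by
  have hbu : ∀ x i, bxor (b x) (u x) i = (b x i ^^ u x i) := fun _ _ => rfl
  have hbv : ∀ x i, bxor (b x) (v x) i = (b x i ^^ v x i) := fun _ _ => rfl
  have hbuv : ∀ x i, bxor (b x) (bxor (u x) (v x)) i = (b x i ^^ (u x i ^^ v x i)) := fun _ _ => rfl
  simp only [hbu, hbv, hbuv]
  have hc : S.card = 0 ∨ S.card = 1 ∨ S.card = 2 ∨ S.card = 3 := by omega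
  rcases hc with hc | hc | hc | hc
  · rw [Finset.card_eq_zero] at hc
    subst hc
    refine rm_isDegLeFun_congr (isDegLeFun_const 3 false) fun x => ?_
    rw [prod_empty]
    rfl
  · obtain ⟨i, rfl⟩ := Finset.card_eq_one.mp hc
    refine rm_isDegLeFun_congr (isDegLeFun_const 3 false) fun x => ?_
    simp only [prod_singleton, ← ind_xor, decide_ind_eq_one]
    exact (cfp_corner1 _ _ _).symm
  · obtain ⟨i, j, hij, rfl⟩ := Finset.card_eq_two.mp hc
    refine rm_isDegLeFun_congr ((hp i j).mono (by norm_num)) fun x => ?_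
    have hi : i ∉ ({j} : Finset (Fin m)) := by simpa using hij
    simp only [prod_insert hi, prod_singleton, ← ind_and, ← ind_xor, decide_ind_eq_one]
    exact (cfp_corner2 _ _ _ _ _ _).symm
  · obtain ⟨i, j, k, hij, hik, hjk, rfl⟩ := Finset.card_eq_three.mp hc
    have hdeg : IsDegLeFun 3 (fun x =>
        (((((u x i && v x j) ^^ (u x j && v x i)) && ((u x i && v x k) ^^ (u x k && v x i))) ^^
            (((u x i && v x j) ^^ (u x j && v x i)) && ((u x j && v x k) ^^ (u x k && v x j))) ^^
            (((u x i && v x k) ^^ (u x k && v x i)) && ((u x j && v x k) ^^ (u x k && v x j)))) ^^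
          ((b x i ^^ (u x i && v x i)) && ((u x j && v x k) ^^ (u x k && v x j))) ^^
          ((b x j ^^ (u x j && v x j)) && ((u x i && v x k) ^^ (u x k && v x i))) ^^
          ((b x k ^^ (u x k && v x k)) && ((u x i && v x j) ^^ (u x j && v x i))))) :=
      fc_deg_bxor (fc_deg_bxor (fc_deg_bxor
        (fc_deg_bxor (fc_deg_bxor (acq_deg_band (hp i j) (hp i k) (by norm_num))
          (acq_deg_band (hp i j) (hp j k) (by norm_num))) (acq_deg_band (hp i k) (hp j k) (by norm_num)))
        (acq_deg_band (hl i) (hp j k) (by norm_num))) (acq_deg_band (hl j) (hp i k) (by norm_num)))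
        (acq_deg_band (hl k) (hp i j) (by norm_num))
    refine rm_isDegLeFun_congr hdeg fun x => ?_
    have hi : i ∉ ({j, k} : Finset (Fin m)) := by simp [hij, hik]
    have hj : j ∉ ({k} : Finset (Fin m)) := by simpa using hjk
    simp only [prod_insert hi, prod_insert hj, prod_singleton, ← ind_and, ← ind_xor, decide_ind_eq_one]
    exact (cfp_corner3 _ _ _ _ _ _ _ _ _).symm

/-! ### The frame-free parity lemma -/

/-- **Frame-free parity lemma.**  Let `h : 𝔽₂^m → 𝔽₂` be cubic and `b u v : 𝔽₂^a → 𝔽₂^m` any maps whose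
Plücker coordinates `x ↦ uᵢ(x)vⱼ(x) ⊕ uⱼ(x)vᵢ(x)` are affine and whose twisted base point
`x ↦ bᵢ(x) ⊕ uᵢ(x)vᵢ(x)` is quadratic (equivalently: `(x‖x₂) ↦ (u(x)·x₂)(v(x)·x₂) ⊕ b(x)·x₂` is cubic).  Then
the second derivative of `h` along the moving plane, `x ↦ ⊕_{σ,τ} h(b(x) ⊕ σu(x) ⊕ τv(x))`, has degree `≤ 3`
(a priori `6`); no affine frame and no degree bound on `u, v, b` themselves is needed. [folklore] -/
theorem cfp_parity_deg {h : (Fin m → Bool) → Bool} (hh : IsDegLeFun 3 h) {b u v : (Fin a → Bool) → (Fin m → Bool)}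
    (hp : ∀ i j, IsDegLeFun 1 (fun x => (u x i && v x j) ^^ (u x j && v x i)))
    (hl : ∀ i, IsDegLeFun 2 (fun x => b x i ^^ (u x i && v x i))) :
    IsDegLeFun 3 (fun x =>
      h (b x) ^^ h (bxor (b x) (u x)) ^^ h (bxor (b x) (v x)) ^^ h (bxor (b x) (bxor (u x) (v x)))) := by
  classical
  obtain ⟨p, hp3, hrep⟩ := hh
  have hev : ∀ y, h y = decide ((∑ d ∈ p.support, p.coeff d * ∏ i ∈ d.support, ind (y i)) = 1) := by
    intro y
    rw [hrep y, polyPhase_apply, cfp_eval_ind]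
  have e : ∀ x, (h (b x) ^^ h (bxor (b x) (u x)) ^^ h (bxor (b x) (v x)) ^^ h (bxor (b x) (bxor (u x) (v x)))) =
      decide ((∑ d ∈ p.support, p.coeff d * ((∏ i ∈ d.support, ind (b x i)) +
        (∏ i ∈ d.support, ind (bxor (b x) (u x) i)) + (∏ i ∈ d.support, ind (bxor (b x) (v x) i)) +
        ∏ i ∈ d.support, ind (bxor (b x) (bxor (u x) (v x)) i))) = 1) := by
    intro x
    rw [hev, hev, hev, hev, ← zmod2_decide_add, ← zmod2_decide_add, ← zmod2_decide_add]
    simp only [mul_add, sum_add_distrib]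
  refine rm_isDegLeFun_congr ?_ fun x => (e x).symm
  refine isDegLeFun_sum (fun d x => p.coeff d * ((∏ i ∈ d.support, ind (b x i)) +
        (∏ i ∈ d.support, ind (bxor (b x) (u x) i)) + (∏ i ∈ d.support, ind (bxor (b x) (v x) i)) +
        ∏ i ∈ d.support, ind (bxor (b x) (bxor (u x) (v x)) i))) p.support fun d hd => ?_
  exact rm_isDegLeFun_congr
    (acq_deg_band (isDegLeFun_const 0 (decide (p.coeff d = 1)))
      (cfp_monomial_deg d.support (cfp_card_support_le hp3 hd) hp hl) (by norm_num))
    fun x => (zmod2_decide_mul _ _).symm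

end Summit.QuantumAdvantage.QuantumAdvantage.Theorems.NearExactIsExact.Negative.CornerFlatPluecker

end
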